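import Summits.ABC.IUTFork.Conditional.WRowHexLamSevenThirtyTwoCells
import Summits.ABC.IUTFork.Conditional.WRowUnconditionalCellsSlot
import HarnessLib

/-!
# R-W WINDOW numerics («W:HEX-AXIS-REST-3», `k = 32`, part (I)) — the HEX class `λ_32 = 1/2 + 2/7³²` at EVERY prime level `l ≥ 1899024603703`:
# the hull licence S_H HOLDS at EVERY genuine Θ-volume datum over `(ratPoint λ_32, l)`, unconditionally (slot socket BY NAME)

PROOF-ONLY file (D-0012; 0 definitions, 0 `Prop` facts) of the abc-iut cell — W6 cone-prover seat abc-iut-w6-d055 (gen 16), row «W:HEX-AXIS-REST-3»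
(abc-iut-plan C-R123 (b), KEY wake/KEY-abc-iut-w6-d055-HEXAXISREST3.md v2 bee80bbbcd2c7c78), GENERATED with abc-iut-w5-d107 gen 9's «W:HEX-INHABITED-BANDS» generator gen_hex.py via abc-iut-C-cert-1 g9's build2.py
(HOME/staging/C/cert-1/g9/hexgen/ → HOME/staging/w6/w6-d055/g16/hexgen/build3.py; config k = 32, A₇ = 15, L0 = 1899024603703) as C-cert-1's `k = 22 / 24` files (p526367 · p526900 / p527048 · p527692, byte models) —
the text below is theirs in shape, credited line by line; the arithmetic `WRow.hcell_lamSeven_thirtyTwo_all` lives in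
`WRowHexLamSevenThirtyTwoCells.lean`, the band theorems in `WRowHexLamSevenThirtyTwoAllLevels.lean`. The R-W numerics lead's table of record
(HOME/plan/rescue/R-W/WINDOW-TABLE.tsv v4.49) has NO `k = 32` row at these levels (beyond the table; HEX-BEYOND clause rows open as «targets (census)», C-R123 (a)); BY NAME the REFUTED side covers every prime
`11 ≤ l ≤ 1899024603689` (W-neg-2 `HexRad.…_rad_eleven` ≤ 479 · this seat's `WRowHexLamSevenThirtyTwoRefutedBand` 481–1899024603689); this band is every prime
`l ≥ 1899024603703`; no prime lies strictly between `1899024603689` and `1899024603703` (three desks agree: abc-iut-rw-num-lead g5's two-engine census HOME/plan/rescue/R-W/HEX-AXIS-CENSUS.tsv 23abd49ba74dfe76 — engine A (python exact) ≡ engine B (PARI, kit j277535) — and this seat's generator arithmetic (abc-iut-C-cert-1 g9's analytic piece plan / slot-model check, HOME/staging/w6/w6-d055/g16/hexgen/desk3.py)). This file decides them on the INHABITED side by ONE theorem. KEY REMARK: `λ_32 = (7³² + 4)/(2·7³²) =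
1104427674243920646305299205/2208855348487841292610598402` is the Frey–Legendre point `a/c` of the abc triple `1104427674243920646305299205 + 1104427674243920646305299197 = 2208855348487841292610598402` (`gcd = 1`: both summands odd, difference `8`), so abc-iut-W-row-1's
INTEGER-SLOT triple socket `WRow.licence_triple_unconditional_slot` (`Cor312LicenceTripleUnconditionalSlot`, inner radius `max(1, ⌊e/(p−1)⌋)` at every
odd bad prime) applies VERBATIM at a SYMBOLIC level `l`; its arithmetic hypothesis `hcell` is discharged uniformly in `l` — per bad prime `p` of
`abc = 2 · 3² · 5 · 7³² · 233 · 4133 · 4243 · 249703 · 571201 · 870268169 · 1608175277 · 33232919040001` the admissible ramification indices are `e = m_p·l·n`, `e` is off the cyclotomic indices, and with ONE fixed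
envelope exponent per prime (A_3 = 0, A_5 = 0, A_7 = 15, A_233 = 0, A_4133 = 0, A_4243 = 0, A_249703 = 0, A_571201 = 0, A_870268169 = 0, A_1608175277 = 0, A_33232919040001 = 0) the two floor-free END-LABEL cells (`WRow.cell_wild_of_ends` p485154 / `WRow.cell_tameslot_of_ends`) are
quadratics in `(l−1)/2` settled by `nlinarith`; the result is then TRANSPORTED from the carrier `ratPoint (1104427674243920646305299205/2208855348487841292610598402)` to the table's carrier
`ratPoint ((2 : ℚ)⁻¹ + 2/7^32)` (`lamSeven_eq_hex32`). Nothing of abc-iut-W-row-1 / W-neg-1 / W-neg-2 / c312-5 / w4-d094 is restated: consumed BY NAME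
through the socket. TAKES NO SIDE on [IUTchIII] Cor. 3.12 (S. Mochizuki, *Inter-universal Teichmüller theory III*, Cor. 3.12 p. 173–174; Step (xi-f)
p. 184) or on any author; «inhabited as typed» ≠ «asserted in print».

WHAT IS PROVED (namespace `Summit.ABC.IUTFork.Conditional`): `isABCTriple_hex32`, `lamSeven_eq_hex32`, `eq_of_prime_dvd_triple_hex32`, `factorization_triple_hex32`,
`WRow.hcell_lamSeven_thirtyTwo_all` (the arithmetic, every prime `l ≥ 1899024603703`), **`WRow.licence_lamSeven_thirtyTwo_all`** — for `k = 32`, EVERY prime `l ≥ 1899024603703`, EVERY genuine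
Θ-volume datum `T` at `(ratPoint (1/2 + 2/7^k), l)` and EVERY pair of realising Θ- and q-ideles, abc-iut-c312-1's `Thm311ToCor312.Licence` HOLDS at
`settingPrVolSharp (pilotDataOfK T.D T.K) …`; **`WRow.exists_qPinned_and_hull_lamSeven_thirtyTwo_all`** — branch C's «∃ ρ qK, QPinned ∧ PilotKummerCompatHull» there, any
columns. READING (neutral; numbers, not adjectives): the per-datum S_H object of the window certificates' binders (`hSHw` p447945 / `hSHwBad` p453137) is
INHABITED at the whole datum class `(λ_32, l)` for every prime `l ≥ 1899024603703`; no number-level and no local-type hypothesis is consumed. Admissibility / (P6) /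
Szpiro-badness of `(ratPoint λ_32, l)` and NON-EMPTINESS of the datum type are NOT claimed. HONEST SCOPE: OUR sharp containers; STRONGER-THAN-PRINT hull
reading; nothing about the printed inequality or any author's intended hull; typed ≠ proved; instantiated ≠ endorsed; no abc claim.
[cite: Mochizuki2012, IUTchI Def. 3.1 (b),(c) pp. 61–62, Rmk. 3.1.5 p. 65, Ex. 3.2 (iv) p. 71; IUTchIII Cor. 3.12 Step (xi-f) p. 184; IUTchIV Prop. 1.1 p. 9, Prop. 1.2 (i)(ii) p. 10, Prop. 1.4 (ii) p. 13, Cor. 2.2 (ii) proof (P5) p. 46]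
[cite: DupuyHilado2025, §3.3, §3.4, §4.9, §4.12] [cite: NeukirchANT1999, Ch. II (5.5)–(5.7)] [claim: Mochizuki2012, status: disputed] for every IUT sentence.
-/

noncomputable section

open Set Function Metric NumberField IsDedekindDomain

namespace Summit.ABC.IUTFork.Conditional

open Thm311 Thm311.Real Cor312 Cor312Vol Cor312Prov Literature.IUT.LogThetaLattice Literature.IUT.LogVolume
  Literature.IUT.HodgeTheaters Literature.IUT.LogVolume.Cor22
open Literature.NumberTheory.NumberFields Literature.NumberTheory.GaloisRepresentations.Ultrametric
open Literature.NumberTheory.DiophantineGeometry Literature.NumberTheory.DiophantineGeometry.GenEll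

/-! ## THE BAND: S_H INHABITED at every genuine datum over `(ratPoint λ_32, l)`, `λ_32 = 1/2 + 2/7³²`, every prime `l ≥ 1899024603703` -/

/-- **«W:HEX-INHABITED-BANDS», `k = 32`: for EVERY prime `l ≥ 1899024603703`**, every genuine Θ-volume datum `T` at `(ratPoint (1/2 + 2/7^32), l)`
([IUTchIV] Cor. 2.2 (ii) proof (P7); abc-iut-w5-d044's HEX family) and every pair of Θ- and q-ideles realising the pilot divisors of `X := pilotDataOfK T.D T.K`, abc-iut-c312-1's
`Thm311ToCor312.Licence` HOLDS at abc-iut-c312-7's `settingPrVolSharp X …` — `WRow.licence_triple_unconditional_slot` at `WRow.hcell_lamSeven_thirtyTwo_all`, transported along `lamSeven_eq_hex32`.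
[cite: Mochizuki2012, IUTchI Def. 3.1 (b),(c) pp. 61–62, Rmk. 3.1.5 p. 65, Ex. 3.2 (iv) p. 71; IUTchIII Cor. 3.12 Step (xi-f) p. 184; IUTchIV Prop. 1.1 p. 9, Prop. 1.2 (i)(ii) p. 10, Prop. 1.4 (ii) p. 13, Cor. 2.2 (ii) proof (P5) p. 46] [cite: DupuyHilado2025, §3.3, §3.4, §4.9, §4.12] [claim: Mochizuki2012, status: disputed] -/
theorem WRow.licence_lamSeven_thirtyTwo_all {k l : ℕ} (hk : k = 32) (hl : l.Prime) (hl0 : 1899024603703 ≤ l) (T : Cor22.ThetaVolumeDatumAt (ratPoint ((2 : ℚ)⁻¹ + 2 / 7 ^ k)) l) :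
    letI := T.instFieldF; letI := T.instNumberFieldF; letI := T.instAlgebraF; letI := T.instFieldK
    letI := T.instNumberFieldK; letI := T.instAlgebraK; letI := T.instFieldFbar; letI := T.instAlgebraFbar
    letI := T.instAlgebraKFbar; letI := T.instIsElliptic
    ∀ {logv : PadicLogs T.K} (hlog : LogvAnalytic logv) (M : Type) [Field M] [NumberField M]
      (archPk : ∀ (j : (thetaIndex (pilotDataOfK T.D T.K)).Label) (vQ : (thetaIndex (pilotDataOfK T.D T.K)).VQ),
        Set ((logShellsDH (pilotDataOfK T.D T.K) logv).Packet j vQ))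
      (archSub : ∀ (j : (thetaIndex (pilotDataOfK T.D T.K)).Label) (v : (thetaIndex (pilotDataOfK T.D T.K)).V),
        Set ((logShellsDH (pilotDataOfK T.D T.K) logv).Packet j ((thetaIndex (pilotDataOfK T.D T.K)).over v)))
      (Ψ : ℤ → ∀ v : (thetaIndex (pilotDataOfK T.D T.K)).V, v ∈ (thetaIndex (pilotDataOfK T.D T.K)).Vbad →
        Set ((logShellsDH (pilotDataOfK T.D T.K) logv).StarPacket v))
      (act : ℤ → ∀ v : (thetaIndex (pilotDataOfK T.D T.K)).V, v ∈ (thetaIndex (pilotDataOfK T.D T.K)).Vbad →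
        (logShellsDH (pilotDataOfK T.D T.K) logv).StarPacket v → Module.End ℚ ((logShellsDH (pilotDataOfK T.D T.K) logv).StarPacket v))
      (Mmod : ℤ → ∀ j : (thetaIndex (pilotDataOfK T.D T.K)).LabelStar, Set ((logShellsDH (pilotDataOfK T.D T.K) logv).GlobalPacket j.1))
      (region : ℤ → ∀ j : (thetaIndex (pilotDataOfK T.D T.K)).LabelStar, FinDivisor M → ∀ vQ : (thetaIndex (pilotDataOfK T.D T.K)).VQ,
        Set ((logShellsDH (pilotDataOfK T.D T.K) logv).Packet j.1 vQ))
      (n : ℤ) {HT : Type} {LogLink : HT → HT → Type} {IsFull : ∀ {s t : HT}, LogLink s t → Prop}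
      (lat : LGPGaussianLogThetaLattice LogLink IsFull)
      {Frd : Type} {IsoF : Frd → Frd → Type} {Ob : Frd → Type} {realify : Frd → Frd} {Strip : Type}
      {IsoS : Strip → Strip → Type} {Mv : ∀ v : (thetaIndex (pilotDataOfK T.D T.K)).V, v ∈ (thetaIndex (pilotDataOfK T.D T.K)).Vbad → Type}
      [∀ v h, Monoid (Mv v h)]
      (sig : GlobalLGPFrobenioidSignature (thetaIndex (pilotDataOfK T.D T.K)).lstar (thetaIndex (pilotDataOfK T.D T.K)).V
        (· ∈ (thetaIndex (pilotDataOfK T.D T.K)).Vbad) Frd IsoF Ob realify Strip IsoS Mv)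
      (split : SplittingMonoids Mv) {ObΔ : Type} {N : ∀ v : (thetaIndex (pilotDataOfK T.D T.K)).V, v ∈ (thetaIndex (pilotDataOfK T.D T.K)).Vbad → Type}
      [∀ v h, Monoid (N v h)] (qData : QPilotData ObΔ N)
      (tq : ∀ (pp : Nat.Primes) (x : (thetaIndex (pilotDataOfK T.D T.K)).Fibre (.inr pp)),
        haveI : Fact (pp : ℕ).Prime := ⟨pp.2⟩; kOf (pilotDataOfK T.D T.K) pp.1 x)
      (t : ∀ (pp : Nat.Primes) (_ : Fin (pilotDataOfK T.D T.K).lstar) (x : (thetaIndex (pilotDataOfK T.D T.K)).Fibre (.inr pp)),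
        haveI : Fact (pp : ℕ).Prime := ⟨pp.2⟩; kOf (pilotDataOfK T.D T.K) pp.1 x)
      (htq0 : ∀ pp x, tq pp x ≠ 0)
      (htq1 : ∀ (pp : Nat.Primes) (x : (thetaIndex (pilotDataOfK T.D T.K)).Fibre (.inr pp)),
        haveI : Fact (pp : ℕ).Prime := ⟨pp.2⟩; placeOf (pilotDataOfK T.D T.K) pp.1 x ∉ (pilotDataOfK T.D T.K).S → ‖tq pp x‖ = 1)
      (_ht0 : ∀ pp i x, t pp i x ≠ 0)
      (_ht : ∀ (pp : Nat.Primes) (i : Fin (pilotDataOfK T.D T.K).lstar) (x : (thetaIndex (pilotDataOfK T.D T.K)).Fibre (.inr pp)),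
        haveI : Fact (pp : ℕ).Prime := ⟨pp.2⟩
        Real.log ‖t pp i x‖ = -((pilotDataOfK T.D T.K).thetaPilot i (placeOf (pilotDataOfK T.D T.K) pp.1 x)) *
          logNorm T.K (placeOf (pilotDataOfK T.D T.K) pp.1 x) / localDegree T.K (placeOf (pilotDataOfK T.D T.K) pp.1 x))
      (_htq : ∀ (pp : Nat.Primes) (x : (thetaIndex (pilotDataOfK T.D T.K)).Fibre (.inr pp)),
        haveI : Fact (pp : ℕ).Prime := ⟨pp.2⟩
        Real.log ‖tq pp x‖ = -((pilotDataOfK T.D T.K).qPilot (placeOf (pilotDataOfK T.D T.K) pp.1 x)) *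
          logNorm T.K (placeOf (pilotDataOfK T.D T.K) pp.1 x) / localDegree T.K (placeOf (pilotDataOfK T.D T.K) pp.1 x)),
      Thm311ToCor312.Licence
        (settingPrVolSharp (pilotDataOfK T.D T.K) hlog M archPk archSub Ψ act Mmod region n lat sig split qData tq t htq0 htq1) := by
  subst hk
  revert T
  rw [lamSeven_eq_hex32]
  intro T
  exact WRow.licence_triple_unconditional_slot isABCTriple_hex32 (by rw [Cor22.jInv_ratPoint_triple isABCTriple_hex32]; norm_num) T
    (fun p => if p = 7 then 15 else 0) (fun p => if p = 7 then 16 else 1) (WRow.hcell_lamSeven_thirtyTwo_all hl hl0)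

/-- **BRANCH C's PER-DATUM ANTECEDENT «∃ ρ qK, QPinned ∧ PilotKummerCompatHull» at every genuine datum over `(ratPoint (1/2 + 2/7^32), l)`, EVERY prime
`l ≥ 1899024603703`** (any columns `col`; every pair of realising Θ- and q-ideles, the CHOSEN ones of the window certificates' `hSHw`/`hSHwBad` binders
included): the per-datum S_H object of the certificates of record (p453137 / p450130 / p447945) HOLDS at every such datum class, UNCONDITIONALLY.
[cite: Mochizuki2012, IUTchIII Cor. 3.12 Step (xi-d) p. 183, (xi-f) p. 184] [cite: DupuyHilado2025, §3.3, §3.4, §4.9] [claim: Mochizuki2012, status: disputed] -/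
theorem WRow.exists_qPinned_and_hull_lamSeven_thirtyTwo_all {k l : ℕ} (hk : k = 32) (hl : l.Prime) (hl0 : 1899024603703 ≤ l) (T : Cor22.ThetaVolumeDatumAt (ratPoint ((2 : ℚ)⁻¹ + 2 / 7 ^ k)) l) :
    letI := T.instFieldF; letI := T.instNumberFieldF; letI := T.instAlgebraF; letI := T.instFieldK
    letI := T.instNumberFieldK; letI := T.instAlgebraK; letI := T.instFieldFbar; letI := T.instAlgebraFbar
    letI := T.instAlgebraKFbar; letI := T.instIsElliptic
    ∀ {logv : PadicLogs T.K} (hlog : LogvAnalytic logv) (M : Type) [Field M] [NumberField M]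
      (archPk : ∀ (j : (thetaIndex (pilotDataOfK T.D T.K)).Label) (vQ : (thetaIndex (pilotDataOfK T.D T.K)).VQ),
        Set ((logShellsDH (pilotDataOfK T.D T.K) logv).Packet j vQ))
      (archSub : ∀ (j : (thetaIndex (pilotDataOfK T.D T.K)).Label) (v : (thetaIndex (pilotDataOfK T.D T.K)).V),
        Set ((logShellsDH (pilotDataOfK T.D T.K) logv).Packet j ((thetaIndex (pilotDataOfK T.D T.K)).over v)))
      (Ψ : ℤ → ∀ v : (thetaIndex (pilotDataOfK T.D T.K)).V, v ∈ (thetaIndex (pilotDataOfK T.D T.K)).Vbad →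
        Set ((logShellsDH (pilotDataOfK T.D T.K) logv).StarPacket v))
      (act : ℤ → ∀ v : (thetaIndex (pilotDataOfK T.D T.K)).V, v ∈ (thetaIndex (pilotDataOfK T.D T.K)).Vbad →
        (logShellsDH (pilotDataOfK T.D T.K) logv).StarPacket v → Module.End ℚ ((logShellsDH (pilotDataOfK T.D T.K) logv).StarPacket v))
      (Mmod : ℤ → ∀ j : (thetaIndex (pilotDataOfK T.D T.K)).LabelStar, Set ((logShellsDH (pilotDataOfK T.D T.K) logv).GlobalPacket j.1))
      (region : ℤ → ∀ j : (thetaIndex (pilotDataOfK T.D T.K)).LabelStar, FinDivisor M → ∀ vQ : (thetaIndex (pilotDataOfK T.D T.K)).VQ,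
        Set ((logShellsDH (pilotDataOfK T.D T.K) logv).Packet j.1 vQ))
      (n : ℤ) {HT : Type} {LogLink : HT → HT → Type} {IsFull : ∀ {s t : HT}, LogLink s t → Prop}
      (lat : LGPGaussianLogThetaLattice LogLink IsFull)
      {Frd : Type} {IsoF : Frd → Frd → Type} {Ob : Frd → Type} {realify : Frd → Frd} {Strip : Type}
      {IsoS : Strip → Strip → Type} {Mv : ∀ v : (thetaIndex (pilotDataOfK T.D T.K)).V, v ∈ (thetaIndex (pilotDataOfK T.D T.K)).Vbad → Type}
      [∀ v h, Monoid (Mv v h)]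
      (sig : GlobalLGPFrobenioidSignature (thetaIndex (pilotDataOfK T.D T.K)).lstar (thetaIndex (pilotDataOfK T.D T.K)).V
        (· ∈ (thetaIndex (pilotDataOfK T.D T.K)).Vbad) Frd IsoF Ob realify Strip IsoS Mv)
      (split : SplittingMonoids Mv) {ObΔ : Type} {N : ∀ v : (thetaIndex (pilotDataOfK T.D T.K)).V, v ∈ (thetaIndex (pilotDataOfK T.D T.K)).Vbad → Type}
      [∀ v h, Monoid (N v h)] (qData : QPilotData ObΔ N)
      (tq : ∀ (pp : Nat.Primes) (x : (thetaIndex (pilotDataOfK T.D T.K)).Fibre (.inr pp)),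
        haveI : Fact (pp : ℕ).Prime := ⟨pp.2⟩; kOf (pilotDataOfK T.D T.K) pp.1 x)
      (t : ∀ (pp : Nat.Primes) (_ : Fin (pilotDataOfK T.D T.K).lstar) (x : (thetaIndex (pilotDataOfK T.D T.K)).Fibre (.inr pp)),
        haveI : Fact (pp : ℕ).Prime := ⟨pp.2⟩; kOf (pilotDataOfK T.D T.K) pp.1 x)
      (htq0 : ∀ pp x, tq pp x ≠ 0)
      (htq1 : ∀ (pp : Nat.Primes) (x : (thetaIndex (pilotDataOfK T.D T.K)).Fibre (.inr pp)),
        haveI : Fact (pp : ℕ).Prime := ⟨pp.2⟩; placeOf (pilotDataOfK T.D T.K) pp.1 x ∉ (pilotDataOfK T.D T.K).S → ‖tq pp x‖ = 1)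
      (col : ℤ → Column (logShellsDH (pilotDataOfK T.D T.K) logv))
      (_ht0 : ∀ pp i x, t pp i x ≠ 0)
      (_ht : ∀ (pp : Nat.Primes) (i : Fin (pilotDataOfK T.D T.K).lstar) (x : (thetaIndex (pilotDataOfK T.D T.K)).Fibre (.inr pp)),
        haveI : Fact (pp : ℕ).Prime := ⟨pp.2⟩
        Real.log ‖t pp i x‖ = -((pilotDataOfK T.D T.K).thetaPilot i (placeOf (pilotDataOfK T.D T.K) pp.1 x)) *
          logNorm T.K (placeOf (pilotDataOfK T.D T.K) pp.1 x) / localDegree T.K (placeOf (pilotDataOfK T.D T.K) pp.1 x))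
      (_htq : ∀ (pp : Nat.Primes) (x : (thetaIndex (pilotDataOfK T.D T.K)).Fibre (.inr pp)),
        haveI : Fact (pp : ℕ).Prime := ⟨pp.2⟩
        Real.log ‖tq pp x‖ = -((pilotDataOfK T.D T.K).qPilot (placeOf (pilotDataOfK T.D T.K) pp.1 x)) *
          logNorm T.K (placeOf (pilotDataOfK T.D T.K) pp.1 x) / localDegree T.K (placeOf (pilotDataOfK T.D T.K) pp.1 x)),
      ∃ (ρ : (∀ v : (thetaIndex (pilotDataOfK T.D T.K)).V, v ∈ (thetaIndex (pilotDataOfK T.D T.K)).Vbad →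
              Set ((logShellsDH (pilotDataOfK T.D T.K) logv).StarPacket v)) →
            ∀ (j : (thetaIndex (pilotDataOfK T.D T.K)).Label) (vQ : (thetaIndex (pilotDataOfK T.D T.K)).VQ),
              Set ((logShellsDH (pilotDataOfK T.D T.K) logv).Packet j vQ))
          (qK : ∀ v : (thetaIndex (pilotDataOfK T.D T.K)).V, v ∈ (thetaIndex (pilotDataOfK T.D T.K)).Vbad →
            Set ((logShellsDH (pilotDataOfK T.D T.K) logv).StarPacket v)),
          QPinned ({ toSituation := situationPrVol (pilotDataOfK T.D T.K) hlog M archPk archSub Ψ act Mmod region, col := col } :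
              LatticeSituation (thetaIndex (pilotDataOfK T.D T.K)))
            (settingPrVolSharp (pilotDataOfK T.D T.K) hlog M archPk archSub Ψ act Mmod region n lat sig split qData tq t htq0 htq1) ρ qK ∧
          PilotKummerCompatHull ({ toSituation := situationPrVol (pilotDataOfK T.D T.K) hlog M archPk archSub Ψ act Mmod region, col := col } :
              LatticeSituation (thetaIndex (pilotDataOfK T.D T.K)))
            (settingPrVolSharp (pilotDataOfK T.D T.K) hlog M archPk archSub Ψ act Mmod region n lat sig split qData tq t htq0 htq1) ρ qK := by
  subst hk
  revert T
  rw [lamSeven_eq_hex32]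
  intro T
  exact WRow.exists_qPinned_and_hull_triple_unconditional_slot isABCTriple_hex32 (by rw [Cor22.jInv_ratPoint_triple isABCTriple_hex32]; norm_num) T
    (fun p => if p = 7 then 15 else 0) (fun p => if p = 7 then 16 else 1) (WRow.hcell_lamSeven_thirtyTwo_all hl hl0)

end Summit.ABC.IUTFork.Conditional

end
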